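import Summits.AtomisticToContinuum.Crystallization.Theorems.SquareWellLayerCakeStackingFaultSparsityLocalFramesCounting
import Summits.AtomisticToContinuum.Crystallization.Theorems.SquareWellLayerCakeStackingFaultSparsityBootstrapShellCensus
import Summits.AtomisticToContinuum.Crystallization.Theorems.SquareWellLayerCakeStackingFaultSparsityBootstrapGapBound
import Summits.AtomisticToContinuum.Crystallization.Theorems.SquareWellLayerCakeStackingFaultSparsityBootstrapStrongRigidity
import Summits.AtomisticToContinuum.Crystallization.Theorems.SquareWellLayerCakeStackingFaultSparsityBootstrapFrameCount
import Literature.MathematicalPhysics.StatisticalMechanics.MatchedWindowTransfer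
import Literature.MathematicalPhysics.StatisticalMechanics.BarlowStacking

/-!
# Radius bootstrap of crux 14294, stub W5 (lead): the window read-back and the counting glue

Crux `StackingFaultSparsity` (stmt-AtomisticToContinuum-14296), line `Sketch`, reshapes 14–15 (lead c8): from the four
LANDED geometric stubs W1 `stub_shellCensus` (relaxed Barlow shell census, p159493), W2 `stub_gapBound` (level gap in the
common-normal case, p159330), W3 `stub_strongRigidity` (strengthened local rigidity, p159339), W4 `stub_frameCount`
(frame count, p159331) to item 14294's registered `stub_radiusBootstrap` VERBATIM (= the registered stub of reshape 15 of
this line, same name and signature): for `R ≥ 2`, `ε > 0` there are `ε', t, R' > 0`, `C ≥ 0` with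
`#{i : ¬GOOD(R, ε)} ≤ C · (#{i : ¬GOOD(2, ε')} + #{i : ¬LAM(t, R')})` for every Lennard-Jones ground state.  Hence item
14294 `LaminarSaturation` needs only its radius-2 energy stub (`laminarSaturation_of_energyGap` in the companion file).

* `readBack_core` — the deterministic read-back: a two-way (here: one-way suffices) `η`-matched window of radius
  `R + 3` onto `barlowStacking a h s` with `19/20 ≤ a ≤ 1`, `19/25 ≤ h`, `(19/20)² ≤ a²/3 + h² ≤ 1`, together with
  separation and the twelve-count at every particle within `R + 3`, gives a GOOD`(R, ε)` frame at the centre: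
  normal = image of the stacking axis, levels `k h`, labels = layer index of the matched stacking point, counts by
  injecting each particle 12-shell into the stacking 12-shell (W1) through the matching.
* `radiusBootstrap_of` — W1 → W2 → W3 → W4 → bootstrap: `η = min ε (1/100) / 4`, the radius `m₀` of W3 at `(R + 3, η)`,
  `m = max m₀ (⌈R⌉₊ + 103)`, `ε' = 1/(m+1)`, `C = (2m/δ + 1)³` (`δ` the proved uniform minimal distance of LJ ground
  states), `t = R' = 1`; the sites whose `m`-ball is not all-GOOD are counted by `card_exists_near_not_le`;
* `stub_radiusBootstrap` — the registered stub, by name and signature (W1–W4 plugged in by name).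
All `[folklore]` bookkeeping.
-/

noncomputable section

namespace Summit.AtomisticToContinuum.Crystallization.Theorems.SquareWellLayerCake.StackingFaultSparsity.Bootstrap.Glue

open Literature.MathematicalPhysics.StatisticalMechanics
open Summit.AtomisticToContinuum.Crystallization.Theorems.SquareWellLayerCake.StackingFaultSparsity.LocalFrames.Counting

/-! ## Small facts -/

/-- Heights in a Barlow stacking differ by integer multiples of the layer spacing. [folklore] -/
theorem exists_sub_two_eq {a h : ℝ} {s : ℤ → ℤ} {q z : EuclideanSpace ℝ (Fin 3)}
    (hq : q ∈ barlowStacking a h s) (hz : z ∈ barlowStacking a h s) : ∃ m : ℤ, q 2 - z 2 = m * h := by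
  obtain ⟨k, i, j, rfl⟩ := hq
  obtain ⟨k', i', j', rfl⟩ := hz
  refine ⟨k - k', ?_⟩
  rw [barlowPos_apply_two, barlowPos_apply_two]
  push_cast
  ring

/-- Inner product with the third basis vector is the third coordinate. [folklore] -/
theorem inner_single_two (u : EuclideanSpace ℝ (Fin 3)) :
    inner ℝ u (EuclideanSpace.single (2 : Fin 3) (1 : ℝ)) = u 2 := by
  rw [EuclideanSpace.inner_single_right]
  simp

/-! ## The read-back -/

/-- **The window read-back** (see the module docstring). [folklore] -/
theorem readBack_core {N : ℕ} (y : Fin N → EuclideanSpace ℝ (Fin 3)) (i : Fin N) {R ε η a h : ℝ}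
    {s : ℤ → ℤ} {z : EuclideanSpace ℝ (Fin 3)}
    (A : EuclideanSpace ℝ (Fin 3) →ₗᵢ[ℝ] EuclideanSpace ℝ (Fin 3))
    (hR : 2 ≤ R) (hη : 0 < η) (hηε : 2 * η ≤ ε) (hη1 : η ≤ 1 / 100)
    (ha1 : 19 / 20 ≤ a) (ha2 : a ≤ 1) (hh : 19 / 25 ≤ h)
    (hlo : (19 / 20) ^ 2 ≤ a ^ 2 / 3 + h ^ 2) (hhi : a ^ 2 / 3 + h ^ 2 ≤ 1)
    (hz : z ∈ barlowStacking a h s)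
    (hW : ∀ j : Fin N, dist (y j) (y i) ≤ R + 3 →
      ∃ p ∈ barlowStacking a h s, dist (y j) (y i + A (p - z)) ≤ η)
    (hShell : ∀ z ∈ Literature.MathematicalPhysics.StatisticalMechanics.barlowStacking a h s, (∀ q ∈ Literature.MathematicalPhysics.StatisticalMechanics.barlowStacking a h s, dist q z ≤ 6 / 5 → q 2 = z 2 ∨ q 2 = z 2 + h ∨ q 2 = z 2 - h) ∧ (∃ F : Finset (EuclideanSpace ℝ (Fin 3)), F.card ≤ 6 ∧ ∀ q ∈ Literature.MathematicalPhysics.StatisticalMechanics.barlowStacking a h s, q ≠ z → dist q z ≤ 6 / 5 → q 2 = z 2 → q ∈ F ∧ dist q z = a) ∧ (∃ F : Finset (EuclideanSpace ℝ (Fin 3)), F.card ≤ 3 ∧ ∀ q ∈ Literature.MathematicalPhysics.StatisticalMechanics.barlowStacking a h s, dist q z ≤ 6 / 5 → q 2 = z 2 + h → q ∈ F ∧ dist q z = √(a ^ 2 / 3 + h ^ 2)) ∧ (∃ F : Finset (EuclideanSpace ℝ (Fin 3)), F.card ≤ 3 ∧ ∀ q ∈ Literature.MathematicalPhysics.StatisticalMechanics.barlowStacking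 a h s, dist q z ≤ 6 / 5 → q 2 = z 2 - h → q ∈ F ∧ dist q z = √(a ^ 2 / 3 + h ^ 2)))
    (hSep : ∀ j : Fin N, dist (y j) (y i) ≤ R + 3 → ∀ k k' : Fin N,
      dist (y k) (y j) ≤ 2 → dist (y k') (y j) ≤ 2 → k ≠ k' → 19 / 20 ≤ dist (y k) (y k'))
    (h12 : ∀ j : Fin N, dist (y j) (y i) ≤ R + 3 → Nat.card {k : Fin N // k ≠ j ∧ dist (y j) (y k) ≤ 1} = 12) :
    (∃ a b : ℝ, 19 / 20 ≤ a ∧ a ≤ 1 ∧ 19 / 20 ≤ b ∧ b ≤ 1 ∧ ∃ n : EuclideanSpace ℝ (Fin 3), ‖n‖ = 1 ∧ ∃ c : ℤ → ℝ, (∀ k : ℤ, c k + 19 / 25 ≤ c (k + 1)) ∧ ∃ l : Fin N → ℤ, (∀ j : Fin N, dist (y j) (y i) ≤ R → |inner ℝ (y j - y i) n - c (l j)| ≤ ε) ∧ (∀ j k : Fin N, dist (y j) (y i) ≤ R → dist (y k) (y i) ≤ R → j ≠ k → 19 / 20 ≤ dist (y j) (y k)) ∧ ∀ j : Fin N, dist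 (y j) (y i) ≤ R / 2 → Nat.card {k : Fin N // k ≠ j ∧ l k = l j ∧ dist (y j) (y k) ≤ 1} = 6 ∧ Nat.card {k : Fin N // l k = l j + 1 ∧ dist (y j) (y k) ≤ 1} = 3 ∧ Nat.card {k : Fin N // l k = l j - 1 ∧ dist (y j) (y k) ≤ 1} = 3 ∧ ∀ k : Fin N, k ≠ j → dist (y j) (y k) ≤ 1 → (l k = l j → |dist (y j) (y k) - a| ≤ ε) ∧ (l k ≠ l j → |dist (y j) (y k) - b| ≤ ε)) := by
  classical
  have hh0 : 0 < h := by linarith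
  have hhne : h ≠ 0 := hh0.ne'
  set S := barlowStacking a h s with hSdef
  set e : EuclideanSpace ℝ (Fin 3) := EuclideanSpace.single (2 : Fin 3) (1 : ℝ) with hedef
  set n : EuclideanSpace ℝ (Fin 3) := A e with hndef
  have hn : ‖n‖ = 1 := by rw [hndef, A.norm_map, hedef, PiLp.norm_single, norm_one]
  -- the matched stacking point of each particle (junk `z` off the window)
  set pp : Fin N → EuclideanSpace ℝ (Fin 3) := fun j =>
    if hj : dist (y j) (y i) ≤ R + 3 then (hW j hj).choose else z with hppdef
  have hpp : ∀ j : Fin N, dist (y j) (y i) ≤ R + 3 → pp j ∈ S ∧ dist (y j) (y i + A (pp j - z)) ≤ η := by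
    intro j hj
    have h1 : pp j = (hW j hj).choose := by simp only [hppdef, dif_pos hj]
    rw [h1]
    exact (hW j hj).choose_spec
  -- labels = layer index relative to `z`
  set l : Fin N → ℤ := fun j => round ((pp j 2 - z 2) / h) with hldef
  have hl : ∀ j : Fin N, dist (y j) (y i) ≤ R + 3 → (pp j 2 - z 2) = (l j : ℝ) * h := by
    intro j hj
    obtain ⟨m, hm⟩ := exists_sub_two_eq (hpp j hj).1 hz
    have : l j = m := by
      show round ((pp j 2 - z 2) / h) = m
      rw [hm, mul_div_cancel_right₀ _ hhne, round_intCast]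
    rw [this, hm]
  -- heights along `n` versus labels
  have hflat : ∀ j : Fin N, dist (y j) (y i) ≤ R + 3 → |inner ℝ (y j - y i) n - h * (l j : ℝ)| ≤ η := by
    intro j hj
    obtain ⟨hpS, hpd⟩ := hpp j hj
    have hsplit : inner ℝ (y j - y i) n = inner ℝ (y j - y i - A (pp j - z)) n + inner ℝ (A (pp j - z)) (A e) := by
      rw [hndef, ← inner_add_left]; congr 1; abel
    have h2 : inner ℝ (A (pp j - z)) (A e) = (l j : ℝ) * h := by
      rw [A.inner_map_map, inner_single_two]
      show (pp j - z) 2 = (l j : ℝ) * h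
      rw [PiLp.sub_apply, hl j hj]
    rw [hsplit, h2]
    have h3 : |inner ℝ (y j - y i - A (pp j - z)) n| ≤ η := by
      refine (abs_real_inner_le_norm _ _).trans ?_
      rw [hn, mul_one]
      have : dist (y j) (y i + A (pp j - z)) = ‖y j - y i - A (pp j - z)‖ := by
        rw [dist_eq_norm]; congr 1; abel
      rw [← this]; exact hpd
    have : inner ℝ (y j - y i - A (pp j - z)) n + (l j : ℝ) * h - h * (l j : ℝ) =
        inner ℝ (y j - y i - A (pp j - z)) n := by ring
    rw [this]; exact h3
  -- distances of matched stacking points versus particle distances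
  have hdd : ∀ j k : Fin N, dist (y j) (y i) ≤ R + 3 → dist (y k) (y i) ≤ R + 3 →
      |dist (y k) (y j) - dist (pp k) (pp j)| ≤ 2 * η := by
    intro j k hj hk
    have h := abs_dist_sub_dist_le_two_mul (hpp k hk).2 (hpp j hj).2
    have hc : dist (y i + A (pp k - z)) (y i + A (pp j - z)) = dist (pp k) (pp j) := by
      rw [dist_add_left, A.isometry.dist_eq, dist_sub_right]
    rwa [hc] at h
  -- labels versus heights of matched stacking points
  have hlab : ∀ j k : Fin N, dist (y j) (y i) ≤ R + 3 → dist (y k) (y i) ≤ R + 3 →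
      (l k = l j ↔ pp k 2 = pp j 2) ∧ (l k = l j + 1 ↔ pp k 2 = pp j 2 + h) ∧
        (l k = l j - 1 ↔ pp k 2 = pp j 2 - h) := by
    intro j k hj hk
    have ej : pp j 2 = (l j : ℝ) * h + z 2 := by linarith [hl j hj]
    have ek : pp k 2 = (l k : ℝ) * h + z 2 := by linarith [hl k hk]
    refine ⟨⟨fun hq => ?_, fun hq => ?_⟩, ⟨fun hq => ?_, fun hq => ?_⟩, ⟨fun hq => ?_, fun hq => ?_⟩⟩
    · rw [ek, ej, hq]
    · have h1 : (l k : ℝ) * h = (l j : ℝ) * h := by linarith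
      exact_mod_cast mul_right_cancel₀ hhne h1
    · rw [ek, ej, hq]; push_cast; ring
    · have h1 : (l k : ℝ) * h = ((l j : ℝ) + 1) * h := by linarith
      have h2 : (l k : ℝ) = (l j : ℝ) + 1 := mul_right_cancel₀ hhne h1
      exact_mod_cast h2
    · rw [ek, ej, hq]; push_cast; ring
    · have h1 : (l k : ℝ) * h = ((l j : ℝ) - 1) * h := by linarith
      have h2 : (l k : ℝ) = (l j : ℝ) - 1 := mul_right_cancel₀ hhne h1
      exact_mod_cast h2
  -- neighbour analysis at a particle `j` of the half window
  have hnb : ∀ j : Fin N, dist (y j) (y i) ≤ R / 2 → ∀ k : Fin N, k ≠ j → dist (y j) (y k) ≤ 1 →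
      dist (y k) (y i) ≤ R + 3 ∧ pp k ∈ S ∧ pp k ≠ pp j ∧ dist (pp k) (pp j) ≤ 6 / 5 ∧
        |dist (y k) (y j) - dist (pp k) (pp j)| ≤ 2 * η := by
    intro j hj k hkj hd1
    have hR0 : 0 ≤ R := by linarith
    have hjR : dist (y j) (y i) ≤ R + 3 := by linarith
    have hkR : dist (y k) (y i) ≤ R + 3 := by
      have h1 := dist_triangle (y k) (y j) (y i)
      rw [dist_comm (y k) (y j)] at h1
      linarith
    have hd := hdd j k hjR hkR
    have hsep1 : 19 / 20 ≤ dist (y k) (y j) :=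
      hSep j hjR k j (by rw [dist_comm]; linarith) (by rw [dist_self]; norm_num) hkj
    have habs := abs_le.1 hd
    refine ⟨hkR, (hpp k hkR).1, ?_, ?_, hd⟩
    · intro heq
      have h0 : dist (pp k) (pp j) = 0 := by rw [heq, dist_self]
      rw [h0] at habs
      linarith [habs.2]
    · rw [dist_comm (y j) (y k)] at hd1
      linarith [habs.1]
  -- injectivity of the matching on the unit shell of a particle of the half window
  have hinj : ∀ j : Fin N, dist (y j) (y i) ≤ R / 2 → ∀ k k' : Fin N,
      dist (y j) (y k) ≤ 1 → dist (y j) (y k') ≤ 1 → pp k = pp k' → k = k' := by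
    intro j hj k k' hk hk' heq
    by_contra hne
    have hR0 : 0 ≤ R := by linarith
    have hjR : dist (y j) (y i) ≤ R + 3 := by linarith
    have hkR : dist (y k) (y i) ≤ R + 3 := by
      have h1 := dist_triangle (y k) (y j) (y i)
      rw [dist_comm (y k) (y j)] at h1
      linarith
    have hk'R : dist (y k') (y i) ≤ R + 3 := by
      have h1 := dist_triangle (y k') (y j) (y i)
      rw [dist_comm (y k') (y j)] at h1
      linarith
    have h1 := (hpp k hkR).2
    have h2 := (hpp k' hk'R).2
    rw [heq] at h1
    have h3 : dist (y k) (y k') ≤ 2 * η := by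
      have := dist_triangle (y k) (y i + A (pp k' - z)) (y k')
      rw [dist_comm (y i + A (pp k' - z)) (y k')] at this
      linarith
    have hs := hSep j hjR k k' (by rw [dist_comm]; linarith) (by rw [dist_comm]; linarith) hne
    linarith
  -- bounds on the second length
  have hb1 : 19 / 20 ≤ √(a ^ 2 / 3 + h ^ 2) := (Real.le_sqrt' (by norm_num)).2 hlo
  have hb2 : √(a ^ 2 / 3 + h ^ 2) ≤ 1 := Real.sqrt_le_one.2 hhi
  -- the frame
  refine ⟨a, √(a ^ 2 / 3 + h ^ 2), ha1, ha2, hb1, hb2, n, hn, fun m => h * m, fun m => ?_, l, ?_, ?_, ?_⟩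
  · show h * ((m : ℤ) : ℝ) + 19 / 25 ≤ h * (((m + 1 : ℤ)) : ℝ)
    push_cast
    nlinarith
  · intro j hj
    have := hflat j (by linarith)
    show |inner ℝ (y j - y i) n - h * (l j : ℝ)| ≤ ε
    linarith
  · intro j k hj _hk hjk
    by_cases h2 : dist (y k) (y j) ≤ 2
    · exact hSep j (by linarith) j k (by rw [dist_self]; norm_num) h2 hjk
    · rw [dist_comm]; linarith
  · intro j hj
    have hR0 : 0 ≤ R := by linarith
    have hjR : dist (y j) (y i) ≤ R + 3 := by linarith
    obtain ⟨hpjS, -⟩ := hpp j hjR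
    obtain ⟨htri, ⟨F6, hF6c, hF6⟩, ⟨Fu, hFuc, hFu⟩, ⟨Fd, hFdc, hFd⟩⟩ := hShell (pp j) hpjS
    set T0 : Finset (Fin N) := Finset.univ.filter (fun k : Fin N => k ≠ j ∧ l k = l j ∧ dist (y j) (y k) ≤ 1)
      with hT0
    set Tu : Finset (Fin N) := Finset.univ.filter (fun k : Fin N => l k = l j + 1 ∧ dist (y j) (y k) ≤ 1) with hTu
    set Td : Finset (Fin N) := Finset.univ.filter (fun k : Fin N => l k = l j - 1 ∧ dist (y j) (y k) ≤ 1) with hTd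
    set Sj : Finset (Fin N) := Finset.univ.filter (fun k : Fin N => k ≠ j ∧ dist (y j) (y k) ≤ 1) with hSj
    have hSj12 : Sj.card = 12 := by
      rw [hSj, ← Fintype.card_subtype, ← Nat.card_eq_fintype_card]; exact h12 j hjR
    -- upper bounds through the matching
    have hT0le : T0.card ≤ 6 := by
      refine le_trans (Finset.card_le_card_of_injOn pp (fun k hk => ?_) ?_) hF6c
      · simp only [hT0, Finset.coe_filter, Set.mem_setOf_eq, Finset.mem_univ, true_and] at hk
        obtain ⟨hkj, hlk, hdk⟩ := hk
        obtain ⟨hkR, hpkS, hne, hd65, -⟩ := hnb j hj k hkj hdk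
        exact Finset.mem_coe.2 (hF6 (pp k) hpkS hne hd65 ((hlab j k hjR hkR).1.1 hlk)).1
      · intro k hk k' hk' heq
        simp only [hT0, Finset.coe_filter, Set.mem_setOf_eq, Finset.mem_univ, true_and] at hk hk'
        exact hinj j hj k k' hk.2.2 hk'.2.2 heq
    have hTule : Tu.card ≤ 3 := by
      refine le_trans (Finset.card_le_card_of_injOn pp (fun k hk => ?_) ?_) hFuc
      · simp only [hTu, Finset.coe_filter, Set.mem_setOf_eq, Finset.mem_univ, true_and] at hk
        obtain ⟨hlk, hdk⟩ := hk
        have hkj : k ≠ j := by rintro rfl; omega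
        obtain ⟨hkR, hpkS, -, hd65, -⟩ := hnb j hj k hkj hdk
        exact Finset.mem_coe.2 (hFu (pp k) hpkS hd65 ((hlab j k hjR hkR).2.1.1 hlk)).1
      · intro k hk k' hk' heq
        simp only [hTu, Finset.coe_filter, Set.mem_setOf_eq, Finset.mem_univ, true_and] at hk hk'
        exact hinj j hj k k' hk.2 hk'.2 heq
    have hTdle : Td.card ≤ 3 := by
      refine le_trans (Finset.card_le_card_of_injOn pp (fun k hk => ?_) ?_) hFdc
      · simp only [hTd, Finset.coe_filter, Set.mem_setOf_eq, Finset.mem_univ, true_and] at hk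
        obtain ⟨hlk, hdk⟩ := hk
        have hkj : k ≠ j := by rintro rfl; omega
        obtain ⟨hkR, hpkS, -, hd65, -⟩ := hnb j hj k hkj hdk
        exact Finset.mem_coe.2 (hFd (pp k) hpkS hd65 ((hlab j k hjR hkR).2.2.1 hlk)).1
      · intro k hk k' hk' heq
        simp only [hTd, Finset.coe_filter, Set.mem_setOf_eq, Finset.mem_univ, true_and] at hk hk'
        exact hinj j hj k k' hk.2 hk'.2 heq
    -- the unit shell of `j` is covered by the three classes
    have hcover : Sj ⊆ T0 ∪ Tu ∪ Td := by
      intro k hk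
      simp only [hSj, Finset.mem_filter, Finset.mem_univ, true_and] at hk
      obtain ⟨hkj, hdk⟩ := hk
      obtain ⟨hkR, hpkS, -, hd65, -⟩ := hnb j hj k hkj hdk
      simp only [Finset.mem_union, hT0, hTu, hTd, Finset.mem_filter, Finset.mem_univ, true_and]
      rcases htri (pp k) hpkS hd65 with h0 | hu | hd
      · exact Or.inl (Or.inl ⟨hkj, (hlab j k hjR hkR).1.2 h0, hdk⟩)
      · exact Or.inl (Or.inr ⟨(hlab j k hjR hkR).2.1.2 hu, hdk⟩)
      · exact Or.inr ⟨(hlab j k hjR hkR).2.2.2 hd, hdk⟩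
    have hsum : 12 ≤ T0.card + Tu.card + Td.card :=
      calc 12 = Sj.card := hSj12.symm
        _ ≤ (T0 ∪ Tu ∪ Td).card := Finset.card_le_card hcover
        _ ≤ (T0 ∪ Tu).card + Td.card := Finset.card_union_le _ _
        _ ≤ T0.card + Tu.card + Td.card := Nat.add_le_add_right (Finset.card_union_le _ _) _
    have hT0eq : T0.card = 6 := by omega
    have hTueq : Tu.card = 3 := by omega
    have hTdeq : Td.card = 3 := by omega
    refine ⟨?_, ?_, ?_, ?_⟩
    · rw [Nat.card_eq_fintype_card, Fintype.card_subtype]; exact hT0eq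
    · rw [Nat.card_eq_fintype_card, Fintype.card_subtype]; exact hTueq
    · rw [Nat.card_eq_fintype_card, Fintype.card_subtype]; exact hTdeq
    · intro k hkj hdk
      obtain ⟨hkR, hpkS, hne, hd65, hdd'⟩ := hnb j hj k hkj hdk
      have habs := abs_le.1 hdd'
      refine ⟨fun hlk => ?_, fun hlk => ?_⟩
      · have hda : dist (pp k) (pp j) = a := (hF6 (pp k) hpkS hne hd65 ((hlab j k hjR hkR).1.1 hlk)).2
        rw [dist_comm (y j) (y k), abs_le]
        constructor <;> linarith
      · rcases htri (pp k) hpkS hd65 with h0 | hu | hd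
        · exact absurd ((hlab j k hjR hkR).1.2 h0) hlk
        · have hdb := (hFu (pp k) hpkS hd65 hu).2
          rw [dist_comm (y j) (y k), abs_le]
          constructor <;> linarith
        · have hdb := (hFd (pp k) hpkS hd65 hd).2
          rw [dist_comm (y j) (y k), abs_le]
          constructor <;> linarith

/-! ## The registered stub -/

/-- GOOD`(2, 1, ε)` frames are monotone in the tolerance. [folklore] -/
theorem good2_mono {N : ℕ} {y : Fin N → EuclideanSpace ℝ (Fin 3)} {jc : Fin N} {ε₁ ε₂ : ℝ}
    (h : (∃ a b : ℝ, 19 / 20 ≤ a ∧ a ≤ 1 ∧ 19 / 20 ≤ b ∧ b ≤ 1 ∧ ∃ n : EuclideanSpace ℝ (Fin 3), ‖n‖ = 1 ∧ ∃ c : ℤ → ℝ, (∀ k : ℤ, c k + 19 / 25 ≤ c (k + 1)) ∧ ∃ l : Fin N → ℤ, (∀ j : Fin N, dist (y j) (y jc) ≤ 2 → |inner ℝ (y j - y jc) n - c (l j)| ≤ ε₁) ∧ (∀ j k : Fin N, dist (y j) (y jc) ≤ 2 → dist (y k) (y jc) ≤ 2 → j ≠ k → 19 / 20 ≤ dist (y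 j) (y k)) ∧ ∀ j : Fin N, dist (y j) (y jc) ≤ 1 → Nat.card {k : Fin N // k ≠ j ∧ l k = l j ∧ dist (y j) (y k) ≤ 1} = 6 ∧ Nat.card {k : Fin N // l k = l j + 1 ∧ dist (y j) (y k) ≤ 1} = 3 ∧ Nat.card {k : Fin N // l k = l j - 1 ∧ dist (y j) (y k) ≤ 1} = 3 ∧ ∀ k : Fin N, k ≠ j → dist (y j) (y k) ≤ 1 → (l k = l j → |dist (y j) (y k) - a| ≤ ε₁) ∧ (l k ≠ l j → |dist (y j) (y k) - b| ≤ ε₁))) (hle : ε₁ ≤ ε₂) :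
    (∃ a b : ℝ, 19 / 20 ≤ a ∧ a ≤ 1 ∧ 19 / 20 ≤ b ∧ b ≤ 1 ∧ ∃ n : EuclideanSpace ℝ (Fin 3), ‖n‖ = 1 ∧ ∃ c : ℤ → ℝ, (∀ k : ℤ, c k + 19 / 25 ≤ c (k + 1)) ∧ ∃ l : Fin N → ℤ, (∀ j : Fin N, dist (y j) (y jc) ≤ 2 → |inner ℝ (y j - y jc) n - c (l j)| ≤ ε₂) ∧ (∀ j k : Fin N, dist (y j) (y jc) ≤ 2 → dist (y k) (y jc) ≤ 2 → j ≠ k → 19 / 20 ≤ dist (y j) (y k)) ∧ ∀ j : Fin N, dist (y j) (y jc) ≤ 1 → Nat.card {k : Fin N // k ≠ j ∧ l k = l j ∧ dist (y j) (y k) ≤ 1} = 6 ∧ Nat.card {k : Fin N // l k = l j + 1 ∧ dist (y j) (y k) ≤ 1} = 3 ∧ Nat.card {k : Fin N // l k = l j - 1 ∧ dist (y j) (y k) ≤ 1} = 3 ∧ ∀ k : Fin N, k ≠ j → dist (y j) (y k) ≤ 1 → (l k = l j → |dist (y j) (y k) - a| ≤ ε₂) ∧ (l k ≠ l j → |dist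 (y j) (y k) - b| ≤ ε₂)) := by
  obtain ⟨a, b, ha1, ha2, hb1, hb2, n, hn, c, hc, l, hfl, hsp, hct⟩ := h
  refine ⟨a, b, ha1, ha2, hb1, hb2, n, hn, c, hc, l, fun j hj => (hfl j hj).trans hle, hsp, fun j hj => ?_⟩
  obtain ⟨h6, hu, hd, hdist⟩ := hct j hj
  exact ⟨h6, hu, hd, fun k hk hdk =>
    ⟨fun hlk => ((hdist k hk hdk).1 hlk).trans hle, fun hlk => ((hdist k hk hdk).2 hlk).trans hle⟩⟩

/-- **The radius bootstrap from the statements of W1–W4** (the glue of reshape 14). [folklore] -/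
theorem radiusBootstrap_of :
    (∀ (a h : ℝ) (s : ℤ → ℤ), Literature.MathematicalPhysics.StatisticalMechanics.IsHaggSeq s → 19 / 20 ≤ a → a ≤ 1 → 19 / 25 ≤ h → a ^ 2 / 3 + h ^ 2 ≤ 1 → ∀ z ∈ Literature.MathematicalPhysics.StatisticalMechanics.barlowStacking a h s, (∀ q ∈ Literature.MathematicalPhysics.StatisticalMechanics.barlowStacking a h s, dist q z ≤ 6 / 5 → q 2 = z 2 ∨ q 2 = z 2 + h ∨ q 2 = z 2 - h) ∧ (∃ F : Finset (EuclideanSpace ℝ (Fin 3)), F.card ≤ 6 ∧ ∀ q ∈ Literature.MathematicalPhysics.StatisticalMechanics.barlowStacking a h s, q ≠ z → dist q z ≤ 6 / 5 → q 2 = z 2 → q ∈ F ∧ dist q z = a) ∧ (∃ F : Finset (EuclideanSpace ℝ (Fin 3)), F.card ≤ 3 ∧ ∀ q ∈ Literature.MathematicalPhysics.StatisticalMechanics.barlowStacking a h s, dist q z ≤ 6 / 5 → q 2 = z 2 + h → q ∈ F ∧ dist q z = √(a ^ 2 / 3 + h ^ 2)) ∧ (∃ F : Finset (EuclideanSpace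 ℝ (Fin 3)), F.card ≤ 3 ∧ ∀ q ∈ Literature.MathematicalPhysics.StatisticalMechanics.barlowStacking a h s, dist q z ≤ 6 / 5 → q 2 = z 2 - h → q ∈ F ∧ dist q z = √(a ^ 2 / 3 + h ^ 2))) → (∀ (X : Set (EuclideanSpace ℝ (Fin 3))) (a b : ℝ) (n : EuclideanSpace ℝ (Fin 3)), X.Nonempty → (∀ p ∈ X, (∃ c : ℤ → ℝ, (19 / 20 ≤ a ∧ a ≤ 1 ∧ 19 / 20 ≤ b ∧ b ≤ 1 ∧ ‖n‖ = 1 ∧ c 0 = 0 ∧ (∀ k : ℤ, c k + 19 / 25 ≤ c (k + 1)) ∧ (∀ q ∈ X, ∀ r ∈ X, q ≠ r → 19 / 20 ≤ dist q r) ∧ (∀ q ∈ X, dist q p < 2 → ∃ k : ℤ, inner ℝ (q - p) n = c k) ∧ (∃ H U D : Finset (EuclideanSpace ℝ (Fin 3)), H.card = 6 ∧ U.card = 3 ∧ D.card = 3 ∧ (∀ q ∈ H, q ∈ X ∧ inner ℝ (q - p) n = 0 ∧ dist p q = a) ∧ (∀ q ∈ U, q ∈ X ∧ inner ℝ (q -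 p) n = c 1 ∧ dist p q = b) ∧ (∀ q ∈ D, q ∈ X ∧ inner ℝ (q - p) n = c (-1) ∧ dist p q = b) ∧ (∀ q ∈ X, q ≠ p → dist q p ≤ 1 → q ∈ H ∨ q ∈ U ∨ q ∈ D)) ∧ (∀ q ∈ X, q ≠ p → dist q p ≤ 1 → (∃ H' : Finset (EuclideanSpace ℝ (Fin 3)), H'.card = 6 ∧ ∀ r ∈ H', r ∈ X ∧ r ≠ q ∧ inner ℝ (r - p) n = inner ℝ (q - p) n ∧ dist q r = a) ∧ (∃ U' : Finset (EuclideanSpace ℝ (Fin 3)), U'.card = 3 ∧ ∀ r ∈ U', r ∈ X ∧ (∃ k : ℤ, inner ℝ (q - p) n = c k ∧ inner ℝ (r - p) n = c (k + 1)) ∧ dist q r = b) ∧ (∃ D' : Finset (EuclideanSpace ℝ (Fin 3)), D'.card = 3 ∧ ∀ r ∈ D', r ∈ X ∧ (∃ k : ℤ, inner ℝ (q - p) n = c k ∧ inner ℝ (r - p) n = c (k - 1)) ∧ dist q r = b) ∧ (∀ r ∈ X, r ≠ q → dist q r < 1 → (inner ℝ (r - p) n = inner ℝ (q - p) n → dist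 q r = a) ∧ (inner ℝ (r - p) n ≠ inner ℝ (q - p) n → dist q r = b))))) ∨ (∃ c : ℤ → ℝ, (19 / 20 ≤ a ∧ a ≤ 1 ∧ 19 / 20 ≤ b ∧ b ≤ 1 ∧ ‖(-n)‖ = 1 ∧ c 0 = 0 ∧ (∀ k : ℤ, c k + 19 / 25 ≤ c (k + 1)) ∧ (∀ q ∈ X, ∀ r ∈ X, q ≠ r → 19 / 20 ≤ dist q r) ∧ (∀ q ∈ X, dist q p < 2 → ∃ k : ℤ, inner ℝ (q - p) (-n) = c k) ∧ (∃ H U D : Finset (EuclideanSpace ℝ (Fin 3)), H.card = 6 ∧ U.card = 3 ∧ D.card = 3 ∧ (∀ q ∈ H, q ∈ X ∧ inner ℝ (q - p) (-n) = 0 ∧ dist p q = a) ∧ (∀ q ∈ U, q ∈ X ∧ inner ℝ (q - p) (-n) = c 1 ∧ dist p q = b) ∧ (∀ q ∈ D, q ∈ X ∧ inner ℝ (q - p) (-n) = c (-1) ∧ dist p q = b) ∧ (∀ q ∈ X, q ≠ p → dist q p ≤ 1 → q ∈ H ∨ q ∈ U ∨ q ∈ D)) ∧ (∀ q ∈ X,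 q ≠ p → dist q p ≤ 1 → (∃ H' : Finset (EuclideanSpace ℝ (Fin 3)), H'.card = 6 ∧ ∀ r ∈ H', r ∈ X ∧ r ≠ q ∧ inner ℝ (r - p) (-n) = inner ℝ (q - p) (-n) ∧ dist q r = a) ∧ (∃ U' : Finset (EuclideanSpace ℝ (Fin 3)), U'.card = 3 ∧ ∀ r ∈ U', r ∈ X ∧ (∃ k : ℤ, inner ℝ (q - p) (-n) = c k ∧ inner ℝ (r - p) (-n) = c (k + 1)) ∧ dist q r = b) ∧ (∃ D' : Finset (EuclideanSpace ℝ (Fin 3)), D'.card = 3 ∧ ∀ r ∈ D', r ∈ X ∧ (∃ k : ℤ, inner ℝ (q - p) (-n) = c k ∧ inner ℝ (r - p) (-n) = c (k - 1)) ∧ dist q r = b) ∧ (∀ r ∈ X, r ≠ q → dist q r < 1 → (inner ℝ (r - p) (-n) = inner ℝ (q - p) (-n) → dist q r = a) ∧ (inner ℝ (r - p) (-n) ≠ inner ℝ (q - p) (-n) → dist q r = b)))))) → 19 / 25 ≤ √(b ^ 2 - a ^ 2 / 3)) → ((∀ (X : Set (EuclideanSpace ℝ (Fin 3))) (a b : ℝ)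 (n : EuclideanSpace ℝ (Fin 3)), X.Nonempty → (∀ p ∈ X, (∃ c : ℤ → ℝ, (19 / 20 ≤ a ∧ a ≤ 1 ∧ 19 / 20 ≤ b ∧ b ≤ 1 ∧ ‖n‖ = 1 ∧ c 0 = 0 ∧ (∀ k : ℤ, c k + 19 / 25 ≤ c (k + 1)) ∧ (∀ q ∈ X, ∀ r ∈ X, q ≠ r → 19 / 20 ≤ dist q r) ∧ (∀ q ∈ X, dist q p < 2 → ∃ k : ℤ, inner ℝ (q - p) n = c k) ∧ (∃ H U D : Finset (EuclideanSpace ℝ (Fin 3)), H.card = 6 ∧ U.card = 3 ∧ D.card = 3 ∧ (∀ q ∈ H, q ∈ X ∧ inner ℝ (q - p) n = 0 ∧ dist p q = a) ∧ (∀ q ∈ U, q ∈ X ∧ inner ℝ (q - p) n = c 1 ∧ dist p q = b) ∧ (∀ q ∈ D, q ∈ X ∧ inner ℝ (q - p) n = c (-1) ∧ dist p q = b) ∧ (∀ q ∈ X, q ≠ p → dist q p ≤ 1 → q ∈ H ∨ q ∈ U ∨ q ∈ D)) ∧ (∀ q ∈ X, q ≠ p → dist q p ≤ 1 → (∃ H'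 : Finset (EuclideanSpace ℝ (Fin 3)), H'.card = 6 ∧ ∀ r ∈ H', r ∈ X ∧ r ≠ q ∧ inner ℝ (r - p) n = inner ℝ (q - p) n ∧ dist q r = a) ∧ (∃ U' : Finset (EuclideanSpace ℝ (Fin 3)), U'.card = 3 ∧ ∀ r ∈ U', r ∈ X ∧ (∃ k : ℤ, inner ℝ (q - p) n = c k ∧ inner ℝ (r - p) n = c (k + 1)) ∧ dist q r = b) ∧ (∃ D' : Finset (EuclideanSpace ℝ (Fin 3)), D'.card = 3 ∧ ∀ r ∈ D', r ∈ X ∧ (∃ k : ℤ, inner ℝ (q - p) n = c k ∧ inner ℝ (r - p) n = c (k - 1)) ∧ dist q r = b) ∧ (∀ r ∈ X, r ≠ q → dist q r < 1 → (inner ℝ (r - p) n = inner ℝ (q - p) n → dist q r = a) ∧ (inner ℝ (r - p) n ≠ inner ℝ (q - p) n → dist q r = b))))) ∨ (∃ c : ℤ → ℝ, (19 / 20 ≤ a ∧ a ≤ 1 ∧ 19 / 20 ≤ b ∧ b ≤ 1 ∧ ‖(-n)‖ = 1 ∧ c 0 = 0 ∧ (∀ k : ℤ, c k + 19 / 25 ≤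 c (k + 1)) ∧ (∀ q ∈ X, ∀ r ∈ X, q ≠ r → 19 / 20 ≤ dist q r) ∧ (∀ q ∈ X, dist q p < 2 → ∃ k : ℤ, inner ℝ (q - p) (-n) = c k) ∧ (∃ H U D : Finset (EuclideanSpace ℝ (Fin 3)), H.card = 6 ∧ U.card = 3 ∧ D.card = 3 ∧ (∀ q ∈ H, q ∈ X ∧ inner ℝ (q - p) (-n) = 0 ∧ dist p q = a) ∧ (∀ q ∈ U, q ∈ X ∧ inner ℝ (q - p) (-n) = c 1 ∧ dist p q = b) ∧ (∀ q ∈ D, q ∈ X ∧ inner ℝ (q - p) (-n) = c (-1) ∧ dist p q = b) ∧ (∀ q ∈ X, q ≠ p → dist q p ≤ 1 → q ∈ H ∨ q ∈ U ∨ q ∈ D)) ∧ (∀ q ∈ X, q ≠ p → dist q p ≤ 1 → (∃ H' : Finset (EuclideanSpace ℝ (Fin 3)), H'.card = 6 ∧ ∀ r ∈ H', r ∈ X ∧ r ≠ q ∧ inner ℝ (r - p) (-n) = inner ℝ (q - p) (-n) ∧ dist q r = a) ∧ (∃ U' : Finset (EuclideanSpace ℝ (Fin 3)), U'.card = 3 ∧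 ∀ r ∈ U', r ∈ X ∧ (∃ k : ℤ, inner ℝ (q - p) (-n) = c k ∧ inner ℝ (r - p) (-n) = c (k + 1)) ∧ dist q r = b) ∧ (∃ D' : Finset (EuclideanSpace ℝ (Fin 3)), D'.card = 3 ∧ ∀ r ∈ D', r ∈ X ∧ (∃ k : ℤ, inner ℝ (q - p) (-n) = c k ∧ inner ℝ (r - p) (-n) = c (k - 1)) ∧ dist q r = b) ∧ (∀ r ∈ X, r ≠ q → dist q r < 1 → (inner ℝ (r - p) (-n) = inner ℝ (q - p) (-n) → dist q r = a) ∧ (inner ℝ (r - p) (-n) ≠ inner ℝ (q - p) (-n) → dist q r = b)))))) → 19 / 25 ≤ √(b ^ 2 - a ^ 2 / 3)) → ∀ R ε : ℝ, 0 < ε → ∃ m : ℕ, ∀ (N : ℕ) (y : Fin N → EuclideanSpace ℝ (Fin 3)) (i : Fin N), (∀ jc : Fin N, dist (y jc) (y i) ≤ (m : ℝ) → (∃ a b : ℝ, 19 / 20 ≤ a ∧ a ≤ 1 ∧ 19 / 20 ≤ b ∧ b ≤ 1 ∧ ∃ n : EuclideanSpace ℝ (Fin 3), ‖n‖ = 1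 ∧ ∃ c : ℤ → ℝ, (∀ k : ℤ, c k + 19 / 25 ≤ c (k + 1)) ∧ ∃ l : Fin N → ℤ, (∀ j : Fin N, dist (y j) (y jc) ≤ 2 → |inner ℝ (y j - y jc) n - c (l j)| ≤ 1 / ((m : ℝ) + 1)) ∧ (∀ j k : Fin N, dist (y j) (y jc) ≤ 2 → dist (y k) (y jc) ≤ 2 → j ≠ k → 19 / 20 ≤ dist (y j) (y k)) ∧ ∀ j : Fin N, dist (y j) (y jc) ≤ 1 → Nat.card {k : Fin N // k ≠ j ∧ l k = l j ∧ dist (y j) (y k) ≤ 1} = 6 ∧ Nat.card {k : Fin N // l k = l j + 1 ∧ dist (y j) (y k) ≤ 1} = 3 ∧ Nat.card {k : Fin N // l k = l j - 1 ∧ dist (y j) (y k) ≤ 1} = 3 ∧ ∀ k : Fin N, k ≠ j → dist (y j) (y k) ≤ 1 → (l k = l j → |dist (y j) (y k) - a| ≤ 1 / ((m : ℝ) + 1)) ∧ (l k ≠ l j → |dist (y j) (y k) - b| ≤ 1 / ((m : ℝ) + 1)))) → ∃ a h : ℝ, 19 / 20 ≤ a ∧ a ≤ 1 ∧ 19 /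 25 ≤ h ∧ (19 / 20) ^ 2 ≤ a ^ 2 / 3 + h ^ 2 ∧ a ^ 2 / 3 + h ^ 2 ≤ 1 ∧ ∃ s : ℤ → ℤ, Literature.MathematicalPhysics.StatisticalMechanics.IsHaggSeq s ∧ ∃ z ∈ Literature.MathematicalPhysics.StatisticalMechanics.barlowStacking a h s, ∃ A : EuclideanSpace ℝ (Fin 3) →ₗᵢ[ℝ] EuclideanSpace ℝ (Fin 3), (∀ p ∈ Literature.MathematicalPhysics.StatisticalMechanics.barlowStacking a h s, dist p z ≤ R → ∃ j : Fin N, dist (y j) (y i + A (p - z)) ≤ ε) ∧ (∀ j : Fin N, dist (y j) (y i) ≤ R → ∃ p ∈ Literature.MathematicalPhysics.StatisticalMechanics.barlowStacking a h s, dist (y j) (y i + A (p - z)) ≤ ε)) → (∀ (N : ℕ) (y : Fin N → EuclideanSpace ℝ (Fin 3)) (i : Fin N) (ε : ℝ), 0 ≤ ε → ε ≤ 1 / 100 → (∃ a b : ℝ, 19 / 20 ≤ a ∧ a ≤ 1 ∧ 19 / 20 ≤ b ∧ b ≤ 1 ∧ ∃ n : EuclideanSpace ℝ (Fin 3), ‖n‖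 = 1 ∧ ∃ c : ℤ → ℝ, (∀ k : ℤ, c k + 19 / 25 ≤ c (k + 1)) ∧ ∃ l : Fin N → ℤ, (∀ j : Fin N, dist (y j) (y i) ≤ 2 → |inner ℝ (y j - y i) n - c (l j)| ≤ ε) ∧ (∀ j k : Fin N, dist (y j) (y i) ≤ 2 → dist (y k) (y i) ≤ 2 → j ≠ k → 19 / 20 ≤ dist (y j) (y k)) ∧ ∀ j : Fin N, dist (y j) (y i) ≤ 1 → Nat.card {k : Fin N // k ≠ j ∧ l k = l j ∧ dist (y j) (y k) ≤ 1} = 6 ∧ Nat.card {k : Fin N // l k = l j + 1 ∧ dist (y j) (y k) ≤ 1} = 3 ∧ Nat.card {k : Fin N // l k = l j - 1 ∧ dist (y j) (y k) ≤ 1} = 3 ∧ ∀ k : Fin N, k ≠ j → dist (y j) (y k) ≤ 1 → (l k = l j → |dist (y j) (y k) - a| ≤ ε) ∧ (l k ≠ l j → |dist (y j) (y k) - b| ≤ ε)) → Nat.card {k : Fin N // k ≠ i ∧ dist (y i) (y k) ≤ 1} = 12) → ∀ R ε : ℝ, 2 ≤ R → 0 < ε → ∃ ε' t R' C : ℝ,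 0 < ε' ∧ 0 < t ∧ 0 < R' ∧ 0 ≤ C ∧ ∀ (N : ℕ) (y : Fin N → EuclideanSpace ℝ (Fin 3)), Literature.MathematicalPhysics.StatisticalMechanics.IsGroundState Literature.MathematicalPhysics.StatisticalMechanics.lennardJones y → (Nat.card {i : Fin N // ¬ (∃ a b : ℝ, 19 / 20 ≤ a ∧ a ≤ 1 ∧ 19 / 20 ≤ b ∧ b ≤ 1 ∧ ∃ n : EuclideanSpace ℝ (Fin 3), ‖n‖ = 1 ∧ ∃ c : ℤ → ℝ, (∀ k : ℤ, c k + 19 / 25 ≤ c (k + 1)) ∧ ∃ l : Fin N → ℤ, (∀ j : Fin N, dist (y j) (y i) ≤ R → |inner ℝ (y j - y i) n - c (l j)| ≤ ε) ∧ (∀ j k : Fin N, dist (y j) (y i) ≤ R → dist (y k) (y i) ≤ R → j ≠ k → 19 / 20 ≤ dist (y j) (y k)) ∧ ∀ j : Fin N, dist (y j) (y i) ≤ R / 2 → Nat.card {k : Fin N // k ≠ j ∧ l k = l j ∧ dist (y j) (y k) ≤ 1} = 6 ∧ Nat.card {k : Fin N // l k = l j + 1 ∧ dist (y j) (y k) ≤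 1} = 3 ∧ Nat.card {k : Fin N // l k = l j - 1 ∧ dist (y j) (y k) ≤ 1} = 3 ∧ ∀ k : Fin N, k ≠ j → dist (y j) (y k) ≤ 1 → (l k = l j → |dist (y j) (y k) - a| ≤ ε) ∧ (l k ≠ l j → |dist (y j) (y k) - b| ≤ ε))} : ℝ) ≤ C * ((Nat.card {i : Fin N // ¬ (∃ a b : ℝ, 19 / 20 ≤ a ∧ a ≤ 1 ∧ 19 / 20 ≤ b ∧ b ≤ 1 ∧ ∃ n : EuclideanSpace ℝ (Fin 3), ‖n‖ = 1 ∧ ∃ c : ℤ → ℝ, (∀ k : ℤ, c k + 19 / 25 ≤ c (k + 1)) ∧ ∃ l : Fin N → ℤ, (∀ j : Fin N, dist (y j) (y i) ≤ 2 → |inner ℝ (y j - y i) n - c (l j)| ≤ ε') ∧ (∀ j k : Fin N, dist (y j) (y i) ≤ 2 → dist (y k) (y i) ≤ 2 → j ≠ k → 19 / 20 ≤ dist (y j) (y k)) ∧ ∀ j : Fin N, dist (y j) (y i) ≤ 1 → Nat.card {k : Fin N // k ≠ j ∧ l k = l j ∧ dist (y j) (y k) ≤ 1} = 6 ∧ Nat.card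 {k : Fin N // l k = l j + 1 ∧ dist (y j) (y k) ≤ 1} = 3 ∧ Nat.card {k : Fin N // l k = l j - 1 ∧ dist (y j) (y k) ≤ 1} = 3 ∧ ∀ k : Fin N, k ≠ j → dist (y j) (y k) ≤ 1 → (l k = l j → |dist (y j) (y k) - a| ≤ ε') ∧ (l k ≠ l j → |dist (y j) (y k) - b| ≤ ε'))} : ℝ) + (Nat.card {i : Fin N // ¬ (∃ n : EuclideanSpace ℝ (Fin 3), ‖n‖ = 1 ∧ ∃ c : ℤ → ℝ, (∀ k : ℤ, c k + 3 / 4 ≤ c (k + 1)) ∧ ∀ j : Fin N, dist (y j) (y i) ≤ R' → ∃ k : ℤ, |inner ℝ (y j - y i) n - c k| ≤ t)} : ℝ)) := by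
  intro hW1 hW2 hW3 hW4 R ε hR hε
  -- tolerances and radii
  set η : ℝ := min ε (1 / 100) / 4 with hηdef
  have hmin0 : 0 < min ε (1 / 100) := lt_min hε (by norm_num)
  have hη0 : 0 < η := by rw [hηdef]; positivity
  have hηε : 2 * η ≤ ε := by
    have h1 : min ε (1 / 100) ≤ ε := min_le_left _ _
    rw [hηdef]; linarith
  have hη1 : η ≤ 1 / 100 := by
    have h1 : min ε (1 / 100) ≤ 1 / 100 := min_le_right _ _
    rw [hηdef]; linarith
  obtain ⟨m₀, hm₀⟩ := hW3 hW2 (R + 3) η hη0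
  obtain ⟨δ, hδ, hsepGS⟩ := LennardJonesMinimalDistance_holds
  set m : ℕ := max m₀ (⌈R⌉₊ + 103) with hmdef
  have hm₀m : m₀ ≤ m := le_max_left _ _
  have hm₂ : ⌈R⌉₊ + 103 ≤ m := le_max_right _ _
  have hm₂' : ((⌈R⌉₊ : ℕ) : ℝ) + 103 ≤ (m : ℝ) := by exact_mod_cast hm₂
  have hmR : R + 3 ≤ (m : ℝ) := by linarith [Nat.le_ceil R]
  have hm100 : (100 : ℝ) ≤ (m : ℝ) + 1 := by linarith [Nat.cast_nonneg (α := ℝ) ⌈R⌉₊]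
  have hε' : 0 < 1 / ((m : ℝ) + 1) := by positivity
  have hε'1 : 1 / ((m : ℝ) + 1) ≤ 1 / 100 := one_div_le_one_div_of_le (by norm_num) hm100
  have hε'm₀ : 1 / ((m : ℝ) + 1) ≤ 1 / ((m₀ : ℝ) + 1) :=
    one_div_le_one_div_of_le (by positivity) (by exact_mod_cast Nat.add_le_add_right hm₀m 1)
  refine ⟨1 / ((m : ℝ) + 1), 1, 1, (2 * (m : ℝ) / δ + 1) ^ 3, hε', one_pos, one_pos, by positivity, ?_⟩
  intro N y hy
  -- the deterministic implication at one site
  have key : ∀ i : Fin N, (∀ jc : Fin N, dist (y jc) (y i) ≤ (m : ℝ) → (∃ a b : ℝ, 19 / 20 ≤ a ∧ a ≤ 1 ∧ 19 / 20 ≤ b ∧ b ≤ 1 ∧ ∃ n : EuclideanSpace ℝ (Fin 3), ‖n‖ = 1 ∧ ∃ c : ℤ → ℝ, (∀ k : ℤ, c k + 19 / 25 ≤ c (k + 1)) ∧ ∃ l : Fin N → ℤ, (∀ j : Fin N, dist (y j) (y jc) ≤ 2 → |inner ℝ (y j - y jc) n - c (l j)| ≤ 1 / ((m : ℝ) + 1))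 ∧ (∀ j k : Fin N, dist (y j) (y jc) ≤ 2 → dist (y k) (y jc) ≤ 2 → j ≠ k → 19 / 20 ≤ dist (y j) (y k)) ∧ ∀ j : Fin N, dist (y j) (y jc) ≤ 1 → Nat.card {k : Fin N // k ≠ j ∧ l k = l j ∧ dist (y j) (y k) ≤ 1} = 6 ∧ Nat.card {k : Fin N // l k = l j + 1 ∧ dist (y j) (y k) ≤ 1} = 3 ∧ Nat.card {k : Fin N // l k = l j - 1 ∧ dist (y j) (y k) ≤ 1} = 3 ∧ ∀ k : Fin N, k ≠ j → dist (y j) (y k) ≤ 1 → (l k = l j → |dist (y j) (y k) - a| ≤ 1 / ((m : ℝ) + 1)) ∧ (l k ≠ l j → |dist (y j) (y k) - b| ≤ 1 / ((m : ℝ) + 1)))) → (∃ a b : ℝ, 19 / 20 ≤ a ∧ a ≤ 1 ∧ 19 / 20 ≤ b ∧ b ≤ 1 ∧ ∃ n : EuclideanSpace ℝ (Fin 3), ‖n‖ = 1 ∧ ∃ c : ℤ → ℝ, (∀ k : ℤ, c k + 19 / 25 ≤ c (k + 1)) ∧ ∃ l : Fin N → ℤ, (∀ j : Fin N, dist (y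 j) (y i) ≤ R → |inner ℝ (y j - y i) n - c (l j)| ≤ ε) ∧ (∀ j k : Fin N, dist (y j) (y i) ≤ R → dist (y k) (y i) ≤ R → j ≠ k → 19 / 20 ≤ dist (y j) (y k)) ∧ ∀ j : Fin N, dist (y j) (y i) ≤ R / 2 → Nat.card {k : Fin N // k ≠ j ∧ l k = l j ∧ dist (y j) (y k) ≤ 1} = 6 ∧ Nat.card {k : Fin N // l k = l j + 1 ∧ dist (y j) (y k) ≤ 1} = 3 ∧ Nat.card {k : Fin N // l k = l j - 1 ∧ dist (y j) (y k) ≤ 1} = 3 ∧ ∀ k : Fin N, k ≠ j → dist (y j) (y k) ≤ 1 → (l k = l j → |dist (y j) (y k) - a| ≤ ε) ∧ (l k ≠ l j → |dist (y j) (y k) - b| ≤ ε)) := by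
    intro i hall
    have hall₀ : ∀ jc : Fin N, dist (y jc) (y i) ≤ (m₀ : ℝ) → (∃ a b : ℝ, 19 / 20 ≤ a ∧ a ≤ 1 ∧ 19 / 20 ≤ b ∧ b ≤ 1 ∧ ∃ n : EuclideanSpace ℝ (Fin 3), ‖n‖ = 1 ∧ ∃ c : ℤ → ℝ, (∀ k : ℤ, c k + 19 / 25 ≤ c (k + 1)) ∧ ∃ l : Fin N → ℤ, (∀ j : Fin N, dist (y j) (y jc) ≤ 2 → |inner ℝ (y j - y jc) n - c (l j)| ≤ 1 / ((m₀ : ℝ) + 1)) ∧ (∀ j k : Fin N, dist (y j) (y jc) ≤ 2 → dist (y k) (y jc) ≤ 2 → j ≠ k → 19 / 20 ≤ dist (y j) (y k)) ∧ ∀ j : Fin N, dist (y j) (y jc) ≤ 1 → Nat.card {k : Fin N // k ≠ j ∧ l k = l j ∧ dist (y j) (y k) ≤ 1} = 6 ∧ Nat.card {k : Fin N // l k = l j + 1 ∧ dist (y j) (y k) ≤ 1} = 3 ∧ Nat.card {k : Fin N // l k = l j - 1 ∧ dist (y j) (y k) ≤ 1} = 3 ∧ ∀ k : Fin N, k ≠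 j → dist (y j) (y k) ≤ 1 → (l k = l j → |dist (y j) (y k) - a| ≤ 1 / ((m₀ : ℝ) + 1)) ∧ (l k ≠ l j → |dist (y j) (y k) - b| ≤ 1 / ((m₀ : ℝ) + 1))) := by
      intro jc hjc
      have hjc' : dist (y jc) (y i) ≤ (m : ℝ) := hjc.trans (by exact_mod_cast hm₀m)
      exact good2_mono (hall jc hjc') hε'm₀
    obtain ⟨a, h, ha1, ha2, hh, hlo, hhi, s, hs, z, hz, A, -, hA2⟩ := hm₀ N y i hall₀
    refine readBack_core y i A hR hη0 hηε hη1 ha1 ha2 hh hlo hhi hz hA2 (hW1 a h s hs ha1 ha2 hh hhi) ?_ ?_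
    · intro j hj k k' hk hk' hkk'
      obtain ⟨_, _, _, _, _, _, _, _, _, _, _, _, hsep, _⟩ := hall j (hj.trans hmR)
      exact hsep k k' hk hk' hkk'
    · intro j hj
      exact hW4 N y j (1 / ((m : ℝ) + 1)) hε'.le hε'1 (hall j (hj.trans hmR))
  -- counting the sites whose `m`-ball is not all-GOOD
  have h1 : (Nat.card {i : Fin N // ¬ (∃ a b : ℝ, 19 / 20 ≤ a ∧ a ≤ 1 ∧ 19 / 20 ≤ b ∧ b ≤ 1 ∧ ∃ n : EuclideanSpace ℝ (Fin 3), ‖n‖ = 1 ∧ ∃ c : ℤ → ℝ, (∀ k : ℤ, c k + 19 / 25 ≤ c (k + 1)) ∧ ∃ l : Fin N → ℤ, (∀ j : Fin N, dist (y j) (y i) ≤ R → |inner ℝ (y j - y i) n - c (l j)| ≤ ε) ∧ (∀ j k : Fin N, dist (y j) (y i) ≤ R → dist (y k) (y i) ≤ R → j ≠ k → 19 / 20 ≤ dist (y j) (y k)) ∧ ∀ j : Fin N, dist (y j) (y i) ≤ R / 2 → Nat.card {k : Fin N // k ≠ j ∧ l k = l j ∧ dist (y j) (y k) ≤ 1}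 = 6 ∧ Nat.card {k : Fin N // l k = l j + 1 ∧ dist (y j) (y k) ≤ 1} = 3 ∧ Nat.card {k : Fin N // l k = l j - 1 ∧ dist (y j) (y k) ≤ 1} = 3 ∧ ∀ k : Fin N, k ≠ j → dist (y j) (y k) ≤ 1 → (l k = l j → |dist (y j) (y k) - a| ≤ ε) ∧ (l k ≠ l j → |dist (y j) (y k) - b| ≤ ε))} : ℝ) ≤
      Nat.card {i : Fin N // ¬ ∀ jc : Fin N, dist (y jc) (y i) ≤ (m : ℝ) → (∃ a b : ℝ, 19 / 20 ≤ a ∧ a ≤ 1 ∧ 19 / 20 ≤ b ∧ b ≤ 1 ∧ ∃ n : EuclideanSpace ℝ (Fin 3), ‖n‖ = 1 ∧ ∃ c : ℤ → ℝ, (∀ k : ℤ, c k + 19 / 25 ≤ c (k + 1)) ∧ ∃ l : Fin N → ℤ, (∀ j : Fin N, dist (y j) (y jc) ≤ 2 → |inner ℝ (y j - y jc) n - c (l j)| ≤ 1 / ((m : ℝ) + 1)) ∧ (∀ j k : Fin N, dist (y j) (y jc) ≤ 2 → dist (y k) (y jc) ≤ 2 → j ≠ k → 19 / 20 ≤ dist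 (y j) (y k)) ∧ ∀ j : Fin N, dist (y j) (y jc) ≤ 1 → Nat.card {k : Fin N // k ≠ j ∧ l k = l j ∧ dist (y j) (y k) ≤ 1} = 6 ∧ Nat.card {k : Fin N // l k = l j + 1 ∧ dist (y j) (y k) ≤ 1} = 3 ∧ Nat.card {k : Fin N // l k = l j - 1 ∧ dist (y j) (y k) ≤ 1} = 3 ∧ ∀ k : Fin N, k ≠ j → dist (y j) (y k) ≤ 1 → (l k = l j → |dist (y j) (y k) - a| ≤ 1 / ((m : ℝ) + 1)) ∧ (l k ≠ l j → |dist (y j) (y k) - b| ≤ 1 / ((m : ℝ) + 1)))} := by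
    refine Nat.cast_le.2 (Nat.card_le_card_of_injective
      (Subtype.map id fun i (hi : ¬ _) (hall : _) => hi (key i hall)) (Subtype.map_injective _ Function.injective_id))
  have h2 := card_exists_near_not_le y (Nat.cast_nonneg m) hδ (fun i k hik => hsepGS N y hy i k hik)
    (fun jc : Fin N => (∃ a b : ℝ, 19 / 20 ≤ a ∧ a ≤ 1 ∧ 19 / 20 ≤ b ∧ b ≤ 1 ∧ ∃ n : EuclideanSpace ℝ (Fin 3), ‖n‖ = 1 ∧ ∃ c : ℤ → ℝ, (∀ k : ℤ, c k + 19 / 25 ≤ c (k + 1)) ∧ ∃ l : Fin N → ℤ, (∀ j : Fin N, dist (y j) (y jc) ≤ 2 → |inner ℝ (y j - y jc) n - c (l j)| ≤ 1 / ((m : ℝ) + 1)) ∧ (∀ j k : Fin N, dist (y j) (y jc) ≤ 2 → dist (y k) (y jc) ≤ 2 → j ≠ k → 19 / 20 ≤ dist (y j) (y k)) ∧ ∀ j : Fin N, dist (y j) (y jc) ≤ 1 → Nat.card {k : Fin N // k ≠ j ∧ l k = l j ∧ dist (y j) (y k) ≤ 1} = 6 ∧ Nat.card {k : Fin N // l k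 = l j + 1 ∧ dist (y j) (y k) ≤ 1} = 3 ∧ Nat.card {k : Fin N // l k = l j - 1 ∧ dist (y j) (y k) ≤ 1} = 3 ∧ ∀ k : Fin N, k ≠ j → dist (y j) (y k) ≤ 1 → (l k = l j → |dist (y j) (y k) - a| ≤ 1 / ((m : ℝ) + 1)) ∧ (l k ≠ l j → |dist (y j) (y k) - b| ≤ 1 / ((m : ℝ) + 1))))
  have hC : (0 : ℝ) ≤ (2 * (m : ℝ) / δ + 1) ^ 3 := by positivity
  calc (Nat.card {i : Fin N // ¬ (∃ a b : ℝ, 19 / 20 ≤ a ∧ a ≤ 1 ∧ 19 / 20 ≤ b ∧ b ≤ 1 ∧ ∃ n : EuclideanSpace ℝ (Fin 3), ‖n‖ = 1 ∧ ∃ c : ℤ → ℝ, (∀ k : ℤ, c k + 19 / 25 ≤ c (k + 1)) ∧ ∃ l : Fin N → ℤ, (∀ j : Fin N, dist (y j) (y i) ≤ R → |inner ℝ (y j - y i) n - c (l j)| ≤ ε) ∧ (∀ j k : Fin N, dist (y j) (y i) ≤ R → dist (y k) (y i) ≤ R → j ≠ k → 19 / 20 ≤ dist (y j) (y k)) ∧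 ∀ j : Fin N, dist (y j) (y i) ≤ R / 2 → Nat.card {k : Fin N // k ≠ j ∧ l k = l j ∧ dist (y j) (y k) ≤ 1} = 6 ∧ Nat.card {k : Fin N // l k = l j + 1 ∧ dist (y j) (y k) ≤ 1} = 3 ∧ Nat.card {k : Fin N // l k = l j - 1 ∧ dist (y j) (y k) ≤ 1} = 3 ∧ ∀ k : Fin N, k ≠ j → dist (y j) (y k) ≤ 1 → (l k = l j → |dist (y j) (y k) - a| ≤ ε) ∧ (l k ≠ l j → |dist (y j) (y k) - b| ≤ ε))} : ℝ)
      ≤ Nat.card {i : Fin N // ¬ ∀ jc : Fin N, dist (y jc) (y i) ≤ (m : ℝ) → (∃ a b : ℝ, 19 / 20 ≤ a ∧ a ≤ 1 ∧ 19 / 20 ≤ b ∧ b ≤ 1 ∧ ∃ n : EuclideanSpace ℝ (Fin 3), ‖n‖ = 1 ∧ ∃ c : ℤ → ℝ, (∀ k : ℤ, c k + 19 / 25 ≤ c (k + 1)) ∧ ∃ l : Fin N → ℤ, (∀ j : Fin N, dist (y j) (y jc) ≤ 2 → |inner ℝ (y j - y jc) n - c (l j)| ≤ 1 / ((m : ℝ)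 + 1)) ∧ (∀ j k : Fin N, dist (y j) (y jc) ≤ 2 → dist (y k) (y jc) ≤ 2 → j ≠ k → 19 / 20 ≤ dist (y j) (y k)) ∧ ∀ j : Fin N, dist (y j) (y jc) ≤ 1 → Nat.card {k : Fin N // k ≠ j ∧ l k = l j ∧ dist (y j) (y k) ≤ 1} = 6 ∧ Nat.card {k : Fin N // l k = l j + 1 ∧ dist (y j) (y k) ≤ 1} = 3 ∧ Nat.card {k : Fin N // l k = l j - 1 ∧ dist (y j) (y k) ≤ 1} = 3 ∧ ∀ k : Fin N, k ≠ j → dist (y j) (y k) ≤ 1 → (l k = l j → |dist (y j) (y k) - a| ≤ 1 / ((m : ℝ) + 1)) ∧ (l k ≠ l j → |dist (y j) (y k) - b| ≤ 1 / ((m : ℝ) + 1)))} := h1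
    _ ≤ (2 * (m : ℝ) / δ + 1) ^ 3 * Nat.card {jc : Fin N // ¬ (∃ a b : ℝ, 19 / 20 ≤ a ∧ a ≤ 1 ∧ 19 / 20 ≤ b ∧ b ≤ 1 ∧ ∃ n : EuclideanSpace ℝ (Fin 3), ‖n‖ = 1 ∧ ∃ c : ℤ → ℝ, (∀ k : ℤ, c k + 19 / 25 ≤ c (k + 1)) ∧ ∃ l : Fin N → ℤ, (∀ j : Fin N, dist (y j) (y jc) ≤ 2 → |inner ℝ (y j - y jc) n - c (l j)| ≤ 1 / ((m : ℝ) + 1)) ∧ (∀ j k : Fin N, dist (y j) (y jc) ≤ 2 → dist (y k) (y jc) ≤ 2 → j ≠ k → 19 / 20 ≤ dist (y j) (y k)) ∧ ∀ j : Fin N, dist (y j) (y jc) ≤ 1 → Nat.card {k : Fin N // k ≠ j ∧ l k = l j ∧ dist (y j) (y k) ≤ 1} = 6 ∧ Nat.card {k : Fin N // l k = l j + 1 ∧ dist (y j) (y k) ≤ 1} = 3 ∧ Nat.card {k : Fin N // l k = l j - 1 ∧ dist (y j) (y k) ≤ 1} = 3 ∧ ∀ k : Fin N, k ≠ j → dist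 (y j) (y k) ≤ 1 → (l k = l j → |dist (y j) (y k) - a| ≤ 1 / ((m : ℝ) + 1)) ∧ (l k ≠ l j → |dist (y j) (y k) - b| ≤ 1 / ((m : ℝ) + 1)))} := h2
    _ ≤ _ := mul_le_mul_of_nonneg_left (le_add_of_nonneg_right (Nat.cast_nonneg _)) hC

/-- **Stub `stub_radiusBootstrap` of line `Sketch` (reshape 15) = item 14294's registered `stub_radiusBootstrap`, by name
and signature**: the landed W1–W4 plugged into `radiusBootstrap_of`. [folklore] -/
theorem stub_radiusBootstrap :
    ∀ R ε : ℝ, 2 ≤ R → 0 < ε → ∃ ε' t R' C : ℝ, 0 < ε' ∧ 0 < t ∧ 0 < R' ∧ 0 ≤ C ∧ ∀ (N : ℕ) (y : Fin N → EuclideanSpace ℝ (Fin 3)), Literature.MathematicalPhysics.StatisticalMechanics.IsGroundState Literature.MathematicalPhysics.StatisticalMechanics.lennardJones y → (Nat.card {i : Fin N // ¬ (∃ a b : ℝ, 19 / 20 ≤ a ∧ a ≤ 1 ∧ 19 / 20 ≤ b ∧ b ≤ 1 ∧ ∃ n : EuclideanSpace ℝ (Fin 3), ‖n‖ = 1 ∧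 ∃ c : ℤ → ℝ, (∀ k : ℤ, c k + 19 / 25 ≤ c (k + 1)) ∧ ∃ l : Fin N → ℤ, (∀ j : Fin N, dist (y j) (y i) ≤ R → |inner ℝ (y j - y i) n - c (l j)| ≤ ε) ∧ (∀ j k : Fin N, dist (y j) (y i) ≤ R → dist (y k) (y i) ≤ R → j ≠ k → 19 / 20 ≤ dist (y j) (y k)) ∧ ∀ j : Fin N, dist (y j) (y i) ≤ R / 2 → Nat.card {k : Fin N // k ≠ j ∧ l k = l j ∧ dist (y j) (y k) ≤ 1} = 6 ∧ Nat.card {k : Fin N // l k = l j + 1 ∧ dist (y j) (y k) ≤ 1} = 3 ∧ Nat.card {k : Fin N // l k = l j - 1 ∧ dist (y j) (y k) ≤ 1} = 3 ∧ ∀ k : Fin N, k ≠ j → dist (y j) (y k) ≤ 1 → (l k = l j → |dist (y j) (y k) - a| ≤ ε) ∧ (l k ≠ l j → |dist (y j) (y k) - b| ≤ ε))} : ℝ) ≤ C * ((Nat.card {i : Fin N // ¬ (∃ a b : ℝ, 19 / 20 ≤ a ∧ a ≤ 1 ∧ 19 / 20 ≤ b ∧ b ≤ 1 ∧ ∃ n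 : EuclideanSpace ℝ (Fin 3), ‖n‖ = 1 ∧ ∃ c : ℤ → ℝ, (∀ k : ℤ, c k + 19 / 25 ≤ c (k + 1)) ∧ ∃ l : Fin N → ℤ, (∀ j : Fin N, dist (y j) (y i) ≤ 2 → |inner ℝ (y j - y i) n - c (l j)| ≤ ε') ∧ (∀ j k : Fin N, dist (y j) (y i) ≤ 2 → dist (y k) (y i) ≤ 2 → j ≠ k → 19 / 20 ≤ dist (y j) (y k)) ∧ ∀ j : Fin N, dist (y j) (y i) ≤ 1 → Nat.card {k : Fin N // k ≠ j ∧ l k = l j ∧ dist (y j) (y k) ≤ 1} = 6 ∧ Nat.card {k : Fin N // l k = l j + 1 ∧ dist (y j) (y k) ≤ 1} = 3 ∧ Nat.card {k : Fin N // l k = l j - 1 ∧ dist (y j) (y k) ≤ 1} = 3 ∧ ∀ k : Fin N, k ≠ j → dist (y j) (y k) ≤ 1 → (l k = l j → |dist (y j) (y k) - a| ≤ ε') ∧ (l k ≠ l j → |dist (y j) (y k) - b| ≤ ε'))} : ℝ) + (Nat.card {i : Fin N // ¬ (∃ n : EuclideanSpace ℝ (Fin 3), ‖n‖ = 1 ∧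 ∃ c : ℤ → ℝ, (∀ k : ℤ, c k + 3 / 4 ≤ c (k + 1)) ∧ ∀ j : Fin N, dist (y j) (y i) ≤ R' → ∃ k : ℤ, |inner ℝ (y j - y i) n - c k| ≤ t)} : ℝ)) :=
  radiusBootstrap_of ShellCensus.stub_shellCensus GapBound.stub_gapBound StrongRigidity.stub_strongRigidity
    FrameCount.stub_frameCount

end Summit.AtomisticToContinuum.Crystallization.Theorems.SquareWellLayerCake.StackingFaultSparsity.Bootstrap.Glue

end
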